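import Summits.HodgeConjecture.HodgeConjecture.Theorems.R90S6LatticeInvDeterminant   -- ★ L1 FILE 3 (brings FILE 1 `relPos`, FILE 2 `relPos_qsInvolution`, `qsInvolution_inv`, ★ W7-f, ★ p03 `R90S6TwistedPolarity`,
                                                                                      --   ★ `UnitaryGroup.coe_qsInvolution_apply`)
import HarnessLib

/-!
# R90 · S6 «Ch. 14.1–14.5 stable TF» — card L2 (row E1.4.4.2.2, layer 2a): THE TWISTED POLARITY `τ_δ : Λ ↦ δ·Λ^♯` IS A TYPE-REVERSING INVOLUTION (up to homothety)
# framed by `g ↦ δ·Θ_σ(g)`: `inv(τΛ, τΛ′) = −w₀·inv(Λ, Λ′)`, `τ²Λ = Nδ·Λ` (`= ϖ^c·Λ` when `Nδ = ϖ^c`), `inv(Λ, τΛ) = (c,…,c) ⟺ τΛ = ϖ^c·Λ`, `Σ inv(Λ, τΛ) ≡ ord det δ (2)`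
# (`Theorems/R90S6TwistedPolarityInvolution.lean`)

Cell `hodgecm-mathlib`, crux H413 (`stmt-HodgeConjecture-24833`), route `HCCMUnconditional`; programme R90-TF, section S6 (base `R90-C14`, dealer R90-C14-plan (g2)), seat
R90-C14-p10 (g0); card **L2** (DEAL 2026-09-05T00:32:32Z l.6523: «τ_δ as a type-reversing involution on the lattice set», generic `N`, the `relPos` currency of ★ L1).  Lane `--kind proof
--supports stmt-HodgeConjecture-24833` (helper; THEOREMS ONLY: no definition, no instance, no notation, no named fact, no `sorry`).  Imports: ★ L1 FILE 3 `Theorems.R90S6LatticeInvDeterminant`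
(hence FILE 1∕2, ★ W7-f, ★ p03 W9-a∕b∕d∕e₁) + HarnessLib; no `Cruxes` import.  The symmetry of `δ` is an EXPLICIT LOCAL HYPOTHESIS `hN : δ·Θ_σ(δ) = ϖ^{(c,…,c)}` (the norm `Nδ` is the
scalar `ϖ^c`); S4's semilocal dress (`epsLoc`, `epsNorm` on `GtLoc L v`) instantiates it per place.

THE MATHEMATICS (Kottwitz 1986 §§1, 3; Rogawski 1990 §1.9–§1.10, §4.10).  `Θ_σ g = w⁰ ᵗ(σg)⁻¹ w⁰`; the twisted polar of `Λ = g·𝒪^N` is `τ_δ Λ = δ·Λ^♯ = (δ Θ_σ g)·𝒪^N` (★ W9-b,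
`mapGL_dualLatt_latt_eq_latt_mul_qsInvolution`), so `τ_δ` is FRAMED by `g ↦ δ·Θ_σ(g)` and every statement below is a `relPos` statement about that frame map:
* §1 `qsInvolution_qsInvolution` (`Θ_σ² = id` for an involution `σ`), `mapGL_dualLatt_latt_eq_latt_mul_qsInvolution` (the frame of `τ_δ Λ`);
* §2 **`relPos_twistFrame`: `inv(τΛ, τΛ′) = −w₀·inv(Λ, Λ′)`** — `τ_δ` REVERSES TYPE (★ L1 `relPos_mul_left` + `relPos_qsInvolution`);
* §3 **`twistFrame_twistFrame`: `δ·Θ(δ·Θ g) = Nδ·g`**, `Nδ = δ·Θ_σ(δ)` (so `τ²Λ = Nδ·Λ`, ★ W9-d's frame form), and under `hN : Nδ = ϖ^{(c,…,c)}`: **`latt_twistFrame_twistFrame_of_norm_eq`: `τ²Λ =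
  (g·ϖ^{c·1})·𝒪^N = ϖ^c·Λ`** — an INVOLUTION on lattice classes (the degenerate, central-norm class) — with `relPos_self_twistFrame_twistFrame_of_norm_eq : inv(Λ, τ²Λ) = (c,…,c)`;
  and for the REGULAR classes (dealer's (2c)): **`latt_twistFrame_twistFrame_of_conj_norm_mem_glInt`**: `Nδ·Λ = Λ ⟹ τ_δ²Λ = Λ` (on the `Nδ`-fixed lattices `τ_δ` is an honest involution) +
  `relPos_self_twistFrame_twistFrame_of_conj_norm_mem_glInt : inv(Λ, τ_δ²Λ) = 0`;
* §4 **`relPos_eq_const_iff_latt_eq` (general): `inv(g·𝒪^N, h·𝒪^N) = (c,…,c) ⟺ h·𝒪^N = (g ϖ^{c·1})·𝒪^N`** (the constant shell is the homothety: `GL_N(𝒪) ϖ^{c·1} GL_N(𝒪) = ϖ^{c·1} GL_N(𝒪)`,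
  `ϖ^{c·1}` central) — at `h = δ Θ_σ g`: «`inv(Λ, τ_δΛ) = (c,…,c) ⟺ δ·Λ^♯ = ϖ^c·Λ`», i.e. `Λ` is self-dual up to `ϖ^c` for the twisted form `h_δ = J₀ δ⁻¹` (★ W9-e₁ `mapGL_dualLatt_eq_dualLatt_mul_inv`:
  `δ·M^{♯,J₀} = M^{♯,J₀δ⁻¹}`) — the hyperspecial vertices of the `U(h_δ)`-building, the unit case E1.4.3.1.2;
* §5 **`sum_relPos_twistFrame_eq`: `Σ_i inv(Λ, τ_δΛ)_i = 2·log v(det g) − log v(det δ)`** (★ L1 FILE 3), hence **`even_sum_relPos_twistFrame_add_log`**: `Σ_i inv(Λ, τ_δΛ)_i ≡ ord(det δ) (mod 2)` for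
  EVERY `Λ` — the shells `{Λ | inv(Λ, τ_δΛ) = a}` with `Σa ≢ ord det δ` are EMPTY (the sign layer reads this).
HONEST LABEL: lattice bookkeeping; proves no printed global statement, discharges no citation; count-neutral helper until E1.4.4.2.3 ∕ E1.4.4.3.1 consume it.  HC_CM is proved only modulo
the 7 printed citations (2 remaining named inputs: hLiu418 = stmt-HodgeConjecture-24832, h413 = stmt-HodgeConjecture-24833) until rung 0 closes.

## References
* [Kottwitz1986BaseChangeUnits] R. Kottwitz, *Base change for unit elements of Hecke algebras*, Compositio Math. 60 (1986), §1 pp. 239–242 (`Nδ`, `X_E`, the twisted fixed cosets), §3.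
* [Rogawski1990] J. D. Rogawski, *Automorphic Representations of Unitary Groups in Three Variables*, Ann. of Math. Stud. 123 (1990), §1.9–§1.10 pp. 8–9, §4.10 pp. 57–58.
* [Macdonald1995] I. G. Macdonald, *Symmetric Functions and Hall Polynomials*, 2nd ed. (1995), Ch. V §2 (2.2), (2.6).
-/
set_option autoImplicit false
-- the mandated namespace repeats the single-problem summit's segment (`HodgeConjecture.HodgeConjecture`)
set_option linter.dupNamespace false

noncomputable section

open scoped Matrix MatrixGroups Valued WithZero
open Literature.NumberTheory.Automorphic Literature.NumberTheory.Automorphic.HermitianLattice Literature.NumberTheory.Automorphic.UnitaryLatticeTree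

namespace Summit.HodgeConjecture.HodgeConjecture.R90.S6

/-! ## §1 `Θ_σ ∘ Θ_σ = id`; the frame of `τ_δ Λ` -/

section Frame

variable {K : Type*} [Field K] {σ : K →+* K} {N : ℕ}

/-- **`Θ_σ(Θ_σ(g)) = g`** for an involution `σ`: the `(i, j)` entry of `Θ_σ(Θ_σ g)` is `σ((Θ_σ g)⁻¹ (rev j) (rev i)) = σ(Θ_σ(g⁻¹) (rev j) (rev i)) = σσ(g i j)` (★ `coe_qsInvolution_apply`,
★ L1 `qsInvolution_inv`). [cite: Rogawski1990, §1.9 p. 8] -/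
theorem qsInvolution_qsInvolution (hσσ : ∀ a, σ (σ a) = a) (g : GL (Fin N) K) :
    UnitaryGroup.qsInvolution σ (UnitaryGroup.qsInvolution σ g) = g := by
  refine Matrix.GeneralLinearGroup.ext fun i j => ?_
  rw [UnitaryGroup.coe_qsInvolution_apply, ← qsInvolution_inv, UnitaryGroup.coe_qsInvolution_apply, inv_inv, Fin.rev_rev, Fin.rev_rev, hσσ]

/-- **`τ² = translation by the norm`, frame form: `δ·Θ_σ(δ·Θ_σ g) = (δ·Θ_σ δ)·g`** (`Θ_σ` multiplicative and involutive). [cite: Kottwitz1986BaseChangeUnits, §1 p. 242] -/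
theorem twistFrame_twistFrame (hσσ : ∀ a, σ (σ a) = a) (δ g : GL (Fin N) K) :
    δ * UnitaryGroup.qsInvolution σ (δ * UnitaryGroup.qsInvolution σ g) = δ * UnitaryGroup.qsInvolution σ δ * g := by
  rw [UnitaryGroup.qsInvolution_mul, qsInvolution_qsInvolution hσσ, mul_assoc]

variable [Valued K ℤᵐ⁰]

/-- **THE FRAME OF THE TWISTED POLAR: `δ·(g·𝒪^N)^♯ = (δ·Θ_σ g)·𝒪^N`** (★ W9-b `mapGL_qsInvolution_stdLattice` read on frames, then ★ `mapGL_latt`). [cite: Rogawski1990, §1.9–§1.10 pp. 8–9]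
[cite: Kottwitz1986BaseChangeUnits, §3] -/
theorem mapGL_dualLatt_latt_eq_latt_mul_qsInvolution (hvσ : ∀ a, Valued.v (σ a) = Valued.v a) (δ g : GL (Fin N) K) :
    mapGL δ (dualLatt σ ((StdForm.antidiagonal N).over K) (latt (g : Matrix (Fin N) (Fin N) K))) =
      latt ((δ * UnitaryGroup.qsInvolution σ g : GL (Fin N) K) : Matrix (Fin N) (Fin N) K) := by
  have h := mapGL_qsInvolution_stdLattice (N := N) hvσ g
  rw [← latt_one, ← Units.val_one, mapGL_latt, mapGL_latt, mul_one, mul_one] at h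
  rw [← h, mapGL_latt]

end Frame

/-! ## §2–§5 The `relPos` laws of the frame map `g ↦ δ·Θ_σ(g)` -/

section RelPos

variable {K : Type*} [Field K] [Valued K ℤᵐ⁰] [ValuativeRel K] [(Valued.v : Valuation K ℤᵐ⁰).Compatible] {σ : K →+* K} {N : ℕ}
  [IsDiscreteValuationRing (ValuativeRel.valuation K).integer] {ϖ : K} (hϖ : IsUniformizingElement ϖ)
include hϖ

/-- **`τ_δ` REVERSES TYPE: `inv(τ_δΛ, τ_δΛ′) = −w₀·inv(Λ, Λ′)`**, frames: `relPos hϖ (δ Θ_σ g) (δ Θ_σ g′) = (i ↦ −relPos hϖ g g′ (rev i))` (★ L1 `relPos_mul_left`, `relPos_qsInvolution`).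
[cite: Kottwitz1986BaseChangeUnits, §3] [cite: Macdonald1995, Ch. V §2 (2.6)] -/
theorem relPos_twistFrame (hvσ : ∀ a, Valued.v (σ a) = Valued.v a) (hσϖ : σ ϖ = ϖ) (δ g g' : GL (Fin N) K) :
    relPos hϖ (δ * UnitaryGroup.qsInvolution σ g) (δ * UnitaryGroup.qsInvolution σ g') = fun i => - relPos hϖ g g' (Fin.rev i) := by
  rw [relPos_mul_left, relPos_qsInvolution hϖ hvσ hσϖ]

/-- **CONSTANT RELATIVE POSITION ⟺ HOMOTHETIC** (general): `relPos hϖ g h = (c,…,c) ⟺ h·𝒪^N = (g·ϖ^{(c,…,c)})·𝒪^N` — the Cartan shell of the central `ϖ^{c·1}` is the single coset `ϖ^{c·1}·GL_N(𝒪)`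
(★ `mul_zpowDiagGL_const_comm`), and cosets are lattices (★ W7-f (i) `latt_eq_latt_iff_mem_glInt`).  At `h = δ·Θ_σ g` (§1): «`inv(Λ, τ_δΛ) = (c,…,c) ⟺ δ·Λ^♯ = ϖ^c·Λ`», i.e. `Λ` is
self-dual up to `ϖ^c` for the twisted form `h_δ = J₀δ⁻¹` (★ W9-e₁ `mapGL_dualLatt_eq_dualLatt_mul_inv`). [cite: Macdonald1995, Ch. V §2 (2.2)] [cite: Kottwitz1986BaseChangeUnits, §3] -/
theorem relPos_eq_const_iff_latt_eq (g h : GL (Fin N) K) (c : ℤ) :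
    relPos hϖ g h = (fun _ : Fin N => c) ↔
      latt (h : Matrix (Fin N) (Fin N) K) = latt ((g * zpowDiagGL hϖ.ne_zero (fun _ : Fin N => c) : GL (Fin N) K) : Matrix (Fin N) (Fin N) K) := by
  rw [latt_eq_latt_iff_mem_glInt, relPos_eq_iff]
  constructor
  · rintro ⟨-, k₁, hk₁, k₂, hk₂, e⟩
    have e' : h⁻¹ * (g * zpowDiagGL hϖ.ne_zero fun _ : Fin N => c) = k₂ * k₁ := by
      have h1 : g⁻¹ * h = k₁⁻¹ * zpowDiagGL hϖ.ne_zero (fun _ : Fin N => c) * k₂⁻¹ := by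
        rw [← e]; group
      calc h⁻¹ * (g * zpowDiagGL hϖ.ne_zero fun _ : Fin N => c)
          = (g⁻¹ * h)⁻¹ * zpowDiagGL hϖ.ne_zero (fun _ : Fin N => c) := by group
        _ = (k₁⁻¹ * zpowDiagGL hϖ.ne_zero (fun _ : Fin N => c) * k₂⁻¹)⁻¹ * zpowDiagGL hϖ.ne_zero (fun _ : Fin N => c) := by rw [h1]
        _ = k₂ * ((zpowDiagGL hϖ.ne_zero (fun _ : Fin N => c))⁻¹ * (k₁ * zpowDiagGL hϖ.ne_zero (fun _ : Fin N => c))) := by group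
        _ = k₂ * ((zpowDiagGL hϖ.ne_zero (fun _ : Fin N => c))⁻¹ * (zpowDiagGL hϖ.ne_zero (fun _ : Fin N => c) * k₁)) := by
            rw [mul_zpowDiagGL_const_comm hϖ.ne_zero c k₁]
        _ = k₂ * k₁ := by group
    rw [e']
    exact (glInt N K).mul_mem hk₂ hk₁
  · intro hk
    refine ⟨antitone_const, 1, (glInt N K).one_mem, h⁻¹ * (g * zpowDiagGL hϖ.ne_zero fun _ : Fin N => c), hk, ?_⟩
    calc 1 * (g⁻¹ * h) * (h⁻¹ * (g * zpowDiagGL hϖ.ne_zero fun _ : Fin N => c)) = zpowDiagGL hϖ.ne_zero (fun _ : Fin N => c) := by group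

omit [(Valued.v : Valuation K ℤᵐ⁰).Compatible] [IsDiscreteValuationRing (ValuativeRel.valuation K).integer] in
/-- **`τ_δ² = THE HOMOTHETY ϖ^c` on lattices when the norm is the scalar `ϖ^c`**: `hN : δ·Θ_σ(δ) = ϖ^{(c,…,c)}` ⟹ `τ_δ(τ_δ Λ)` is framed by `g·ϖ^{(c,…,c)}`, i.e. `τ_δ²Λ = ϖ^c·Λ` — `τ_δ` is an
INVOLUTION on lattice classes (frames: §1 `twistFrame_twistFrame`, then centrality ★ `mul_zpowDiagGL_const_comm`). [cite: Kottwitz1986BaseChangeUnits, §1 p. 242] -/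
theorem latt_twistFrame_twistFrame_of_norm_eq (hσσ : ∀ a, σ (σ a) = a) {δ : GL (Fin N) K} {c : ℤ}
    (hN : δ * UnitaryGroup.qsInvolution σ δ = zpowDiagGL hϖ.ne_zero (fun _ : Fin N => c)) (g : GL (Fin N) K) :
    latt ((δ * UnitaryGroup.qsInvolution σ (δ * UnitaryGroup.qsInvolution σ g) : GL (Fin N) K) : Matrix (Fin N) (Fin N) K) =
      latt ((g * zpowDiagGL hϖ.ne_zero (fun _ : Fin N => c) : GL (Fin N) K) : Matrix (Fin N) (Fin N) K) := by
  rw [twistFrame_twistFrame hσσ, hN, mul_zpowDiagGL_const_comm hϖ.ne_zero c g]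

/-- **`inv(Λ, τ_δ²Λ) = (c,…,c)`** under `hN : δ·Θ_σ(δ) = ϖ^{(c,…,c)}` (§4 with §3). [cite: Kottwitz1986BaseChangeUnits, §1 p. 242] -/
theorem relPos_self_twistFrame_twistFrame_of_norm_eq (hσσ : ∀ a, σ (σ a) = a) {δ : GL (Fin N) K} {c : ℤ}
    (hN : δ * UnitaryGroup.qsInvolution σ δ = zpowDiagGL hϖ.ne_zero (fun _ : Fin N => c)) (g : GL (Fin N) K) :
    relPos hϖ g (δ * UnitaryGroup.qsInvolution σ (δ * UnitaryGroup.qsInvolution σ g)) = fun _ : Fin N => c :=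
  (relPos_eq_const_iff_latt_eq hϖ g _ c).2 (latt_twistFrame_twistFrame_of_norm_eq hϖ hσσ hN g)

omit [IsDiscreteValuationRing (ValuativeRel.valuation K).integer] hϖ in
/-- **ON THE `Nδ`-FIXED LATTICES `τ_δ` IS AN HONEST INVOLUTION**: if the norm `Nδ = δ·Θ_σ(δ)` fixes `Λ = g·𝒪^N` (`g⁻¹·Nδ·g ∈ GL_N(𝒪)`, i.e. `Nδ·Λ = Λ`), then `τ_δ(τ_δ Λ) = Λ` — the class the
twisted orbital integrals range over has `Nδ` conjugate to a regular `γ`, and the relevant lattices are the `γ`-fixed ones (dealer's (2c); §3 frame form + ★ W7-f (i) `latt_eq_latt_iff_mem_glInt`).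
[cite: Kottwitz1986BaseChangeUnits, §1 p. 242, §3] -/
theorem latt_twistFrame_twistFrame_of_conj_norm_mem_glInt (hσσ : ∀ a, σ (σ a) = a) (δ g : GL (Fin N) K)
    (hγ : g⁻¹ * (δ * UnitaryGroup.qsInvolution σ δ) * g ∈ glInt N K) :
    latt ((δ * UnitaryGroup.qsInvolution σ (δ * UnitaryGroup.qsInvolution σ g) : GL (Fin N) K) : Matrix (Fin N) (Fin N) K) = latt (g : Matrix (Fin N) (Fin N) K) := by
  rw [twistFrame_twistFrame hσσ, eq_comm, latt_eq_latt_iff_mem_glInt, ← mul_assoc]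
  exact hγ

/-- **`inv(Λ, τ_δ²Λ) = 0` on the `Nδ`-fixed lattices** (the `relPos` form of `latt_twistFrame_twistFrame_of_conj_norm_mem_glInt`, ★ L1 `relPos_eq_of_latt_eq` + `relPos_self`).
[cite: Kottwitz1986BaseChangeUnits, §3] -/
theorem relPos_self_twistFrame_twistFrame_of_conj_norm_mem_glInt (hσσ : ∀ a, σ (σ a) = a) (δ g : GL (Fin N) K)
    (hγ : g⁻¹ * (δ * UnitaryGroup.qsInvolution σ δ) * g ∈ glInt N K) :
    relPos hϖ g (δ * UnitaryGroup.qsInvolution σ (δ * UnitaryGroup.qsInvolution σ g)) = 0 := by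
  rw [relPos_eq_of_latt_eq hϖ rfl (latt_twistFrame_twistFrame_of_conj_norm_mem_glInt hσσ δ g hγ), relPos_self]

/-- **`Σ_i inv(Λ, τ_δΛ)_i = 2·log v(det g) − log v(det δ)`** (`Λ = g·𝒪^N`; ★ L1 FILE 3 `sum_relPos_eq_log_sub_log`, `v_det_qsInvolution`). [cite: Kottwitz1986BaseChangeUnits, §3] -/
theorem sum_relPos_twistFrame_eq (hvϖ : Valued.v ϖ = WithZero.exp (-1 : ℤ)) (hvσ : ∀ a, Valued.v (σ a) = Valued.v a) (δ g : GL (Fin N) K) :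
    ∑ i, relPos hϖ g (δ * UnitaryGroup.qsInvolution σ g) i =
      2 * WithZero.log (Valued.v (g : Matrix (Fin N) (Fin N) K).det) - WithZero.log (Valued.v (δ : Matrix (Fin N) (Fin N) K).det) := by
  have hg : Valued.v (g : Matrix (Fin N) (Fin N) K).det ≠ 0 := (Valuation.ne_zero_iff _).2 (Matrix.isUnits_det_units g).ne_zero
  have hδ : Valued.v (δ : Matrix (Fin N) (Fin N) K).det ≠ 0 := (Valuation.ne_zero_iff _).2 (Matrix.isUnits_det_units δ).ne_zero
  rw [sum_relPos_eq_log_sub_log hϖ hvϖ, Units.val_mul, Matrix.det_mul, map_mul, v_det_qsInvolution hvσ,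
    WithZero.log_mul hδ (inv_ne_zero hg), WithZero.log_inv]
  ring

/-- **THE PARITY LAW OF THE TWISTED SHELLS: `Σ_i inv(Λ, τ_δΛ)_i ≡ ord(det δ) (mod 2)` for EVERY full-rank `Λ`** — `Σ_i relPos hϖ g (δ Θ_σ g) i + log v(det δ)` is even; so the shells
`{Λ | inv(Λ, τ_δΛ) = a}` with `Σa + log v(det δ)` odd are EMPTY. [cite: Kottwitz1986BaseChangeUnits, §3] -/
theorem even_sum_relPos_twistFrame_add_log (hvϖ : Valued.v ϖ = WithZero.exp (-1 : ℤ)) (hvσ : ∀ a, Valued.v (σ a) = Valued.v a) (δ g : GL (Fin N) K) :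
    Even (∑ i, relPos hϖ g (δ * UnitaryGroup.qsInvolution σ g) i + WithZero.log (Valued.v (δ : Matrix (Fin N) (Fin N) K).det)) :=
  ⟨WithZero.log (Valued.v (g : Matrix (Fin N) (Fin N) K).det), by rw [sum_relPos_twistFrame_eq hϖ hvϖ hvσ]; ring⟩

end RelPos

end Summit.HodgeConjecture.HodgeConjecture.R90.S6

end
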